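import Literature.MathematicalPhysics.QuantumFieldTheory.Balaban1983to89.B4Lower18

/-!
# NE7K1LinFineOpWeight — row NE7 (node U5), candidate route HOM, path H1L, cell K1-lin(s), U = 1 instance, piece 1: the
# Combes–Thomas CONJUGATION ERROR of Bałaban's `A = 0` operator `−Δ^η_Ω + aP_k(0)` (tree `B4Lower18.fineOpR n a 0 R`, any
# finite union `R` of blocks) at an ARBITRARY weight with bond oscillation `≤ δ′·η` and block oscillation `≤ Θ` is
# `≥ −(2(d+1)δ′² + a(e^Θ − 1))‖w‖²` — the `herr` hypothesis of `Beta.CombesThomasForm.combesThomas_form`, `η`-FREE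

Lineage `b2b-balaban-t4-ne7-p2` (CRUX PROVER NE7 #2), generation 63.  Context: `Support/NE7K1LinSchurLineForm` (p285160) proves
s-uniform weighted decay of the interpolated-Schur propagator line from TWO hypotheses on each endpoint — a coercivity floor
(for `fineOpR` this is `B4Lower18.lower18_zero`, B4 (1.8) at `A = 0`) and a conjugation-error bound at a weight `ρ`.  The
lineage's `B4Lower18.setDecay_region` feeds these to `CombesThomasFormOp.setDecay_lattice_dist` INTERNALLY for the special
weight `δ·dist(·,T)`; THIS FILE exposes the conjugation-error bound for a GENERAL weight `φ` (what the two-cutoff instance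
needs: run B's weight is the pull-back of run A's weight along the block map, not a distance-to-a-set on run B's lattice):

* **`conjError_fineOpR_ge`** — `n ≥ 1`, `R` a union of `n`-blocks, `a ≥ 0`, `δ′·(1∕n) ≤ 1`, `0 ≤ Θ`,
  `|φ x − φ y| ≤ δ′∕n` for nearest neighbours and `|φ x − φ y| ≤ Θ` within a block ⇒ for every `w`,
  `−(2(d+1)δ′² + a(e^Θ − 1))·‖w‖² ≤ Σ_{x,y}(e^{φ_x−φ_y} − 1)·(fineOpR n a 0 R)_{xy}·w_x w_y`.

Mechanism = the tree's, re-exposed: `B4Lower18.fineOpR_zero_eq` (the operator IS `lap (adjC n R) + Σ_b (a∕|b|)1_b⊗1_b`),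
`Beta.CombesThomasForm.lapDefect_le` (bond defects, `z = 2(d+1)` from `card_filter_adjC_ne_zero_le`), `blockDefect_le`, and
`CombesThomasFormOp.conjError_lap_add_blocks_ge`.  [folklore] throughout; 0 Bałaban letters beyond the tree's `fineOpR`;
nothing printed asserted; no `sorry`.  HONEST FRAMING: FIXED FINITE T⁴, rung (B)+1; NE7 NOT PRINTED ∕ NOT PROVED; spine 0∕9;
NOT infinite volume, NOT mass gap, NOT Clay.  HONEST DEPENDENCY: continuum YM on T⁴ ⇐ BetaPertH ∧ nine spine estimates (0/9
proved); BetaPertH ⇐ (D1) ∧ (D4) ∧ CAP+tail; G-an2-4 gates asym, D1 and NE2/3/4.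
-/

noncomputable section

open Finset Matrix

namespace Summit.QuantumFields.BalabanUV.T4Continuum.NE7K1LinFineOpWeight

open Literature.MathematicalPhysics.QuantumFieldTheory.Balaban1983to89
open Literature.MathematicalPhysics.QuantumFieldTheory.Balaban1983to89.B4Reflection242
open Literature.MathematicalPhysics.QuantumFieldTheory.Balaban1983to89.B4BoxCov237
open Literature.MathematicalPhysics.QuantumFieldTheory.Balaban1983to89.B4Lower18
open Literature.MathematicalPhysics.QuantumFieldTheory.Balaban1983to89.Beta.CombesThomasForm (lapDefect_le blockDefect_le)
open Literature.MathematicalPhysics.QuantumFieldTheory.Balaban1983to89.Beta.CombesThomasFormOp (conjError_lap_add_blocks_ge)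

variable {d : ℕ}

/-- **CONJUGATION ERROR OF `−Δ^η_Ω + aP_k(0)` AT A GENERAL WEIGHT, `η`-FREE.**  For `n ≥ 1` (`η = 1∕n`), `R ⊂ ℤ^{d+1}` a finite
union of `n`-blocks, `a ≥ 0`, and a weight `φ : R → ℝ` with `|φ x − φ y| ≤ δ′∕n` across nearest-neighbour bonds
(`δ′∕n ≤ 1`) and `|φ x − φ y| ≤ Θ` (`Θ ≥ 0`) inside each block:
`−(2(d+1)δ′² + a(e^Θ − 1))‖w‖² ≤ Σ_{x,y}(e^{φ_x−φ_y} − 1)(fineOpR n a 0 R)_{xy}w_xw_y` for every `w` — the second hypothesis of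
`Beta.CombesThomasForm.combesThomas_form` for Bałaban's `A = 0` operator, with a constant in which `η` does not appear.
[cite: CombesThomas1973, §II] [folklore] -/
theorem conjError_fineOpR_ge {n : ℕ} (hn : 1 ≤ n) {R : Finset (Fin (d + 1) → ℤ)} (hR : IsBlockUnion n R)
    {a δ' Θ : ℝ} (ha : 0 ≤ a) (hδ1 : δ' * (1 / (n : ℝ)) ≤ 1) (hΘ0 : 0 ≤ Θ) (φ : ↥R → ℝ)
    (hbond : ∀ x y : ↥R, y.1 ∈ nbrs x.1 → |φ x - φ y| ≤ δ' * (1 / (n : ℝ)))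
    (hblock : ∀ x y : ↥R, blk n x.1 = blk n y.1 → |φ x - φ y| ≤ Θ) (w : ↥R → ℝ) :
    -(2 * ((d : ℝ) + 1) * δ' ^ 2 + a * (Real.exp Θ - 1)) * (w ⬝ᵥ w)
      ≤ ∑ x, ∑ y, (Real.exp (φ x - φ y) - 1) * fineOpR n a 0 R x y * (w x * w y) := by
  classical
  have hn0 : (0 : ℝ) < n := by exact_mod_cast hn
  have hη : (0 : ℝ) < 1 / (n : ℝ) := by positivity
  have hε0 : 0 ≤ Real.exp Θ - 1 := by linarith [Real.add_one_le_exp Θ]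
  have hcard : ∀ b : ↥(R.image (blk n)),
      ((Finset.univ.filter fun i => rblk n R i = b).card : ℝ) = (n : ℝ) ^ (d + 1) := by
    intro b
    rw [card_filter_rblk hn hR b]
    push_cast
    rfl
  -- bond data: coefficient `η⁻² = n²` and weight oscillation `≤ δ′·η`
  have hc : ∀ j k : ↥R, adjC n R j k ≠ 0 → adjC n R j k = ((1 / (n : ℝ)) ^ 2)⁻¹ ∧ |φ j - φ k| ≤ δ' * (1 / (n : ℝ)) := by
    intro j k hjk
    have hadj : k.1 ∈ nbrs j.1 := by
      by_contra h
      exact hjk (if_neg h)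
    refine ⟨?_, hbond j k hadj⟩
    simp only [adjC, hadj, if_true]
    field_simp
  -- block data: oscillation `≤ Θ` on blocks (labels compared in `R.image (blk n)`)
  have hΘ : ∀ j k : ↥R, rblk n R j = rblk n R k → |φ j - φ k| ≤ Θ := fun j k hjk =>
    hblock j k (congrArg Subtype.val hjk)
  -- block strengths: `(a/|b|)·|b| = a`
  have hstr : ∀ b : ↥(R.image (blk n)),
      a / ((Finset.univ.filter fun i => rblk n R i = b).card : ℝ) * (Real.exp Θ - 1) *
          ∑ k : ↥R, (if rblk n R k = b then (1 : ℝ) else 0) ^ 2 ≤ a * (Real.exp Θ - 1) := by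
    intro b
    have hsq : ∑ k : ↥R, (if rblk n R k = b then (1 : ℝ) else 0) ^ 2
        = ((Finset.univ.filter fun i => rblk n R i = b).card : ℝ) := by
      simp_rw [ite_pow, one_pow, zero_pow two_ne_zero]
      rw [Finset.sum_boole]
    rw [hsq, hcard]
    have hpow : ((n : ℝ) ^ (d + 1)) ≠ 0 := by positivity
    rw [mul_assoc, mul_comm (Real.exp Θ - 1), ← mul_assoc, div_mul_cancel₀ a hpow]
  have h := conjError_lap_add_blocks_ge (adjC n R) (adjC_symm n R) (adjC_nonneg n R) (rblk n R)
    (fun b => a / ((Finset.univ.filter fun i => rblk n R i = b).card : ℝ))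
    (fun b => div_nonneg ha (Nat.cast_nonneg _))
    (fun b j => if rblk n R j = b then (1 : ℝ) else 0) (fun b j hj => if_neg hj)
    (fineOpR n a 0 R) (fineOpR_zero_eq hn hR a) φ (2 * ((d : ℝ) + 1) * δ' ^ 2) (a * (Real.exp Θ - 1))
    (fun j => (lapDefect_le (adjC n R) φ hη hδ1 hc (fun j => card_filter_adjC_ne_zero_le n R j) j).trans_eq
      (by ring))
    (fun _ => Real.exp Θ - 1) (fun _ => hε0) (fun b j k hj hk => blockDefect_le (rblk n R) φ Θ hΘ b j k hj hk)
    hstr w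
  exact h

end Summit.QuantumFields.BalabanUV.T4Continuum.NE7K1LinFineOpWeight
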